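import Literature.NumberTheory.Irrationality.KrattenthalerZudilin2019.EqEightCertificate
import HarnessLib

/-!
# Krattenthaler–Zudilin 2019, §4 eq. (8): the certificate identity `certE m w = 0` (kernel verification)

Proofs-only file 2 of the eq. (8) chain (see `EqEightCertificate.lean` for the objects and the route).
First the plumbing for the data definitions: `map_certY`/`map_certE` (compatibility with ring homomorphisms,
used with `Polynomial.evalRingHom`) and `natDegree_certY_le` (degree in `w`).
The cleared creative-telescoping identity of the well-poised `₅F₄` side of [KrattenthalerZudilin2019, §4
eq. (8)] is the vanishing of `certE m w` (an integer polynomial identity of degree 25 in `w` and 34 in `m`,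
with the 366-monomial certificate `certY`). It is verified here WITHOUT expanding it as a bivariate
polynomial (which exceeds one `ring` call at the default limits): for each of the 27 sample points
`w₀ = 0, 1, …, 26` the specialisation `certE m w₀ = 0` is a univariate identity in `m` closed by `ring` after
unfolding the data (`certE_at_0`, …, `certE_at_26`), and `w ↦ certE m w` is (the evaluation of) a polynomial
of degree ≤ 26 over `ℝ` (`natDegree_certE_le`, from `natDegree_certY_le`), so it vanishes identically
(`Polynomial.eq_zero_of_natDegree_lt_card_of_eval_eq_zero`): `certE_eq_zero`.
HONEST FRAMING (cell pub-zeta5): systematic search; an identity between explicitly given polynomials;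
nothing here concerns `ζ(5)`. Theorems only; statement files untouched.
-/

open Finset Polynomial

namespace Literature.NumberTheory.Irrationality.KrattenthalerZudilin2019

namespace EqEight

variable {R : Type*} [CommRing R]

/-! ### Compatibility with ring homomorphisms -/

/-- Horner evaluation commutes with ring homomorphisms. [folklore] -/
private theorem map_hornerRows {S : Type*} [CommRing S] (f : R →+* S) (L : List (List (ℕ × ℤ))) (m w : R) :
    f (hornerRows L m w) = hornerRows L (f m) (f w) := by
  induction L with
  | nil => simp [hornerRows]
  | cons row L ih =>
    simp only [hornerRows, List.foldr_cons, map_add, map_mul] at ih ⊢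
    rw [ih, map_list_sum, List.map_map]
    have hrow : List.map (⇑f ∘ fun t : ℕ × ℤ => (t.2 : R) * m ^ t.1) row
        = List.map (fun t : ℕ × ℤ => (t.2 : S) * f m ^ t.1) row :=
      List.map_congr_left fun t _ => by simp only [Function.comp_apply, map_mul, map_pow, map_intCast]
    rw [hrow]

/-- `certY` commutes with ring homomorphisms. Plumbing for the computed certificate of
[cite: KrattenthalerZudilin2019, §4 eq. (8)]. -/
theorem map_certY {S : Type*} [CommRing S] (f : R →+* S) (m w : R) :
    f (certY m w) = certY (f m) (f w) :=
  map_hornerRows f certRows m w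

/-- `certE` commutes with ring homomorphisms. Plumbing for the computed certificate of
[cite: KrattenthalerZudilin2019, §4 eq. (8)]. -/
theorem map_certE {S : Type*} [CommRing S] (f : R →+* S) (m w : R) :
    f (certE m w) = certE (f m) (f w) := by
  simp only [certE, certA, certB, certRHS, map_sub, map_add, map_mul, map_pow, map_ofNat, map_neg, map_one,
    map_certY]

/-! ### The certificate as a polynomial in `w`: degree bounds -/

/-- Horner recursion, one row. [folklore] -/
private theorem hornerRows_cons (row : List (ℕ × ℤ)) (L : List (List (ℕ × ℤ))) (m w : R) :
    hornerRows (row :: L) m w = (row.map fun t : ℕ × ℤ => (t.2 : R) * m ^ t.1).sum + w * hornerRows L m w := by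
  simp [hornerRows]

open Polynomial in
/-- With a constant first argument `C m`, a Horner evaluation at a polynomial `q` has degree at most
`(number of rows) · deg q`. [folklore] -/
private theorem natDegree_hornerRows_le (L : List (List (ℕ × ℤ))) (m : ℝ) (q : ℝ[X]) :
    (hornerRows L (C m) q).natDegree ≤ L.length * q.natDegree := by
  induction L with
  | nil => simp [hornerRows]
  | cons row L ih =>
    rw [hornerRows_cons, List.length_cons, add_one_mul]
    have hrow : (row.map fun t : ℕ × ℤ => (t.2 : ℝ[X]) * C m ^ t.1).sum
        = C ((row.map fun t : ℕ × ℤ => (t.2 : ℝ) * m ^ t.1).sum) := by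
      rw [map_list_sum, List.map_map]
      refine congrArg List.sum (List.map_congr_left fun t _ => ?_)
      simp only [Function.comp_apply, map_mul, map_pow, map_intCast]
    rw [hrow]
    refine (natDegree_add_le _ _).trans (max_le (by simp) ?_)
    refine natDegree_mul_le.trans ?_
    rw [add_comm (L.length * q.natDegree)]
    exact Nat.add_le_add_left ih _

open Polynomial in
/-- `deg_w certY(C m, q) ≤ 21 · deg q`. Computed certificate for [cite: KrattenthalerZudilin2019, §4 eq. (8)]. -/
theorem natDegree_certY_le (m : ℝ) (q : ℝ[X]) : (certY (C m) q).natDegree ≤ 21 * q.natDegree := by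
  have h := natDegree_hornerRows_le certRows m q
  have hl : certRows.length = 21 := by simp [certRows]
  rwa [hl] at h


/-! ### The 27 specialisations `certE m w₀ = 0`, `w₀ = 0, …, 26` -/

/-- The cleared certificate identity at `w = 0`. Computed certificate for
[cite: KrattenthalerZudilin2019, §4 eq. (8)]. -/
theorem certE_at_0 (m : ℝ) : certE m ((0 : ℕ) : ℝ) = 0 := by
  simp only [certE, certA, certB, certRHS, certY, hornerRows, certRows, List.foldr_cons, List.foldr_nil,
    List.map_cons, List.map_nil, List.sum_cons, List.sum_nil]
  push_cast
  ring

/-- The cleared certificate identity at `w = 1`. Computed certificate for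
[cite: KrattenthalerZudilin2019, §4 eq. (8)]. -/
theorem certE_at_1 (m : ℝ) : certE m ((1 : ℕ) : ℝ) = 0 := by
  simp only [certE, certA, certB, certRHS, certY, hornerRows, certRows, List.foldr_cons, List.foldr_nil,
    List.map_cons, List.map_nil, List.sum_cons, List.sum_nil]
  push_cast
  ring

/-- The cleared certificate identity at `w = 2`. Computed certificate for
[cite: KrattenthalerZudilin2019, §4 eq. (8)]. -/
theorem certE_at_2 (m : ℝ) : certE m ((2 : ℕ) : ℝ) = 0 := by
  simp only [certE, certA, certB, certRHS, certY, hornerRows, certRows, List.foldr_cons, List.foldr_nil,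
    List.map_cons, List.map_nil, List.sum_cons, List.sum_nil]
  push_cast
  ring

/-- The cleared certificate identity at `w = 3`. Computed certificate for
[cite: KrattenthalerZudilin2019, §4 eq. (8)]. -/
theorem certE_at_3 (m : ℝ) : certE m ((3 : ℕ) : ℝ) = 0 := by
  simp only [certE, certA, certB, certRHS, certY, hornerRows, certRows, List.foldr_cons, List.foldr_nil,
    List.map_cons, List.map_nil, List.sum_cons, List.sum_nil]
  push_cast
  ring

/-- The cleared certificate identity at `w = 4`. Computed certificate for
[cite: KrattenthalerZudilin2019, §4 eq. (8)]. -/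
theorem certE_at_4 (m : ℝ) : certE m ((4 : ℕ) : ℝ) = 0 := by
  simp only [certE, certA, certB, certRHS, certY, hornerRows, certRows, List.foldr_cons, List.foldr_nil,
    List.map_cons, List.map_nil, List.sum_cons, List.sum_nil]
  push_cast
  ring

/-- The cleared certificate identity at `w = 5`. Computed certificate for
[cite: KrattenthalerZudilin2019, §4 eq. (8)]. -/
theorem certE_at_5 (m : ℝ) : certE m ((5 : ℕ) : ℝ) = 0 := by
  simp only [certE, certA, certB, certRHS, certY, hornerRows, certRows, List.foldr_cons, List.foldr_nil,
    List.map_cons, List.map_nil, List.sum_cons, List.sum_nil]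
  push_cast
  ring

/-- The cleared certificate identity at `w = 6`. Computed certificate for
[cite: KrattenthalerZudilin2019, §4 eq. (8)]. -/
theorem certE_at_6 (m : ℝ) : certE m ((6 : ℕ) : ℝ) = 0 := by
  simp only [certE, certA, certB, certRHS, certY, hornerRows, certRows, List.foldr_cons, List.foldr_nil,
    List.map_cons, List.map_nil, List.sum_cons, List.sum_nil]
  push_cast
  ring

/-- The cleared certificate identity at `w = 7`. Computed certificate for
[cite: KrattenthalerZudilin2019, §4 eq. (8)]. -/
theorem certE_at_7 (m : ℝ) : certE m ((7 : ℕ) : ℝ) = 0 := by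
  simp only [certE, certA, certB, certRHS, certY, hornerRows, certRows, List.foldr_cons, List.foldr_nil,
    List.map_cons, List.map_nil, List.sum_cons, List.sum_nil]
  push_cast
  ring

/-- The cleared certificate identity at `w = 8`. Computed certificate for
[cite: KrattenthalerZudilin2019, §4 eq. (8)]. -/
theorem certE_at_8 (m : ℝ) : certE m ((8 : ℕ) : ℝ) = 0 := by
  simp only [certE, certA, certB, certRHS, certY, hornerRows, certRows, List.foldr_cons, List.foldr_nil,
    List.map_cons, List.map_nil, List.sum_cons, List.sum_nil]
  push_cast
  ring

/-- The cleared certificate identity at `w = 9`. Computed certificate for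
[cite: KrattenthalerZudilin2019, §4 eq. (8)]. -/
theorem certE_at_9 (m : ℝ) : certE m ((9 : ℕ) : ℝ) = 0 := by
  simp only [certE, certA, certB, certRHS, certY, hornerRows, certRows, List.foldr_cons, List.foldr_nil,
    List.map_cons, List.map_nil, List.sum_cons, List.sum_nil]
  push_cast
  ring

/-- The cleared certificate identity at `w = 10`. Computed certificate for
[cite: KrattenthalerZudilin2019, §4 eq. (8)]. -/
theorem certE_at_10 (m : ℝ) : certE m ((10 : ℕ) : ℝ) = 0 := by
  simp only [certE, certA, certB, certRHS, certY, hornerRows, certRows, List.foldr_cons, List.foldr_nil,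
    List.map_cons, List.map_nil, List.sum_cons, List.sum_nil]
  push_cast
  ring

/-- The cleared certificate identity at `w = 11`. Computed certificate for
[cite: KrattenthalerZudilin2019, §4 eq. (8)]. -/
theorem certE_at_11 (m : ℝ) : certE m ((11 : ℕ) : ℝ) = 0 := by
  simp only [certE, certA, certB, certRHS, certY, hornerRows, certRows, List.foldr_cons, List.foldr_nil,
    List.map_cons, List.map_nil, List.sum_cons, List.sum_nil]
  push_cast
  ring

/-- The cleared certificate identity at `w = 12`. Computed certificate for
[cite: KrattenthalerZudilin2019, §4 eq. (8)]. -/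
theorem certE_at_12 (m : ℝ) : certE m ((12 : ℕ) : ℝ) = 0 := by
  simp only [certE, certA, certB, certRHS, certY, hornerRows, certRows, List.foldr_cons, List.foldr_nil,
    List.map_cons, List.map_nil, List.sum_cons, List.sum_nil]
  push_cast
  ring

/-- The cleared certificate identity at `w = 13`. Computed certificate for
[cite: KrattenthalerZudilin2019, §4 eq. (8)]. -/
theorem certE_at_13 (m : ℝ) : certE m ((13 : ℕ) : ℝ) = 0 := by
  simp only [certE, certA, certB, certRHS, certY, hornerRows, certRows, List.foldr_cons, List.foldr_nil,
    List.map_cons, List.map_nil, List.sum_cons, List.sum_nil]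
  push_cast
  ring

/-- The cleared certificate identity at `w = 14`. Computed certificate for
[cite: KrattenthalerZudilin2019, §4 eq. (8)]. -/
theorem certE_at_14 (m : ℝ) : certE m ((14 : ℕ) : ℝ) = 0 := by
  simp only [certE, certA, certB, certRHS, certY, hornerRows, certRows, List.foldr_cons, List.foldr_nil,
    List.map_cons, List.map_nil, List.sum_cons, List.sum_nil]
  push_cast
  ring

/-- The cleared certificate identity at `w = 15`. Computed certificate for
[cite: KrattenthalerZudilin2019, §4 eq. (8)]. -/
theorem certE_at_15 (m : ℝ) : certE m ((15 : ℕ) : ℝ) = 0 := by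
  simp only [certE, certA, certB, certRHS, certY, hornerRows, certRows, List.foldr_cons, List.foldr_nil,
    List.map_cons, List.map_nil, List.sum_cons, List.sum_nil]
  push_cast
  ring

/-- The cleared certificate identity at `w = 16`. Computed certificate for
[cite: KrattenthalerZudilin2019, §4 eq. (8)]. -/
theorem certE_at_16 (m : ℝ) : certE m ((16 : ℕ) : ℝ) = 0 := by
  simp only [certE, certA, certB, certRHS, certY, hornerRows, certRows, List.foldr_cons, List.foldr_nil,
    List.map_cons, List.map_nil, List.sum_cons, List.sum_nil]
  push_cast
  ring

/-- The cleared certificate identity at `w = 17`. Computed certificate for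
[cite: KrattenthalerZudilin2019, §4 eq. (8)]. -/
theorem certE_at_17 (m : ℝ) : certE m ((17 : ℕ) : ℝ) = 0 := by
  simp only [certE, certA, certB, certRHS, certY, hornerRows, certRows, List.foldr_cons, List.foldr_nil,
    List.map_cons, List.map_nil, List.sum_cons, List.sum_nil]
  push_cast
  ring

/-- The cleared certificate identity at `w = 18`. Computed certificate for
[cite: KrattenthalerZudilin2019, §4 eq. (8)]. -/
theorem certE_at_18 (m : ℝ) : certE m ((18 : ℕ) : ℝ) = 0 := by
  simp only [certE, certA, certB, certRHS, certY, hornerRows, certRows, List.foldr_cons, List.foldr_nil,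
    List.map_cons, List.map_nil, List.sum_cons, List.sum_nil]
  push_cast
  ring

/-- The cleared certificate identity at `w = 19`. Computed certificate for
[cite: KrattenthalerZudilin2019, §4 eq. (8)]. -/
theorem certE_at_19 (m : ℝ) : certE m ((19 : ℕ) : ℝ) = 0 := by
  simp only [certE, certA, certB, certRHS, certY, hornerRows, certRows, List.foldr_cons, List.foldr_nil,
    List.map_cons, List.map_nil, List.sum_cons, List.sum_nil]
  push_cast
  ring

/-- The cleared certificate identity at `w = 20`. Computed certificate for
[cite: KrattenthalerZudilin2019, §4 eq. (8)]. -/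
theorem certE_at_20 (m : ℝ) : certE m ((20 : ℕ) : ℝ) = 0 := by
  simp only [certE, certA, certB, certRHS, certY, hornerRows, certRows, List.foldr_cons, List.foldr_nil,
    List.map_cons, List.map_nil, List.sum_cons, List.sum_nil]
  push_cast
  ring

/-- The cleared certificate identity at `w = 21`. Computed certificate for
[cite: KrattenthalerZudilin2019, §4 eq. (8)]. -/
theorem certE_at_21 (m : ℝ) : certE m ((21 : ℕ) : ℝ) = 0 := by
  simp only [certE, certA, certB, certRHS, certY, hornerRows, certRows, List.foldr_cons, List.foldr_nil,
    List.map_cons, List.map_nil, List.sum_cons, List.sum_nil]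
  push_cast
  ring

/-- The cleared certificate identity at `w = 22`. Computed certificate for
[cite: KrattenthalerZudilin2019, §4 eq. (8)]. -/
theorem certE_at_22 (m : ℝ) : certE m ((22 : ℕ) : ℝ) = 0 := by
  simp only [certE, certA, certB, certRHS, certY, hornerRows, certRows, List.foldr_cons, List.foldr_nil,
    List.map_cons, List.map_nil, List.sum_cons, List.sum_nil]
  push_cast
  ring

/-- The cleared certificate identity at `w = 23`. Computed certificate for
[cite: KrattenthalerZudilin2019, §4 eq. (8)]. -/
theorem certE_at_23 (m : ℝ) : certE m ((23 : ℕ) : ℝ) = 0 := by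
  simp only [certE, certA, certB, certRHS, certY, hornerRows, certRows, List.foldr_cons, List.foldr_nil,
    List.map_cons, List.map_nil, List.sum_cons, List.sum_nil]
  push_cast
  ring

/-- The cleared certificate identity at `w = 24`. Computed certificate for
[cite: KrattenthalerZudilin2019, §4 eq. (8)]. -/
theorem certE_at_24 (m : ℝ) : certE m ((24 : ℕ) : ℝ) = 0 := by
  simp only [certE, certA, certB, certRHS, certY, hornerRows, certRows, List.foldr_cons, List.foldr_nil,
    List.map_cons, List.map_nil, List.sum_cons, List.sum_nil]
  push_cast
  ring

/-- The cleared certificate identity at `w = 25`. Computed certificate for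
[cite: KrattenthalerZudilin2019, §4 eq. (8)]. -/
theorem certE_at_25 (m : ℝ) : certE m ((25 : ℕ) : ℝ) = 0 := by
  simp only [certE, certA, certB, certRHS, certY, hornerRows, certRows, List.foldr_cons, List.foldr_nil,
    List.map_cons, List.map_nil, List.sum_cons, List.sum_nil]
  push_cast
  ring

/-- The cleared certificate identity at `w = 26`. Computed certificate for
[cite: KrattenthalerZudilin2019, §4 eq. (8)]. -/
theorem certE_at_26 (m : ℝ) : certE m ((26 : ℕ) : ℝ) = 0 := by
  simp only [certE, certA, certB, certRHS, certY, hornerRows, certRows, List.foldr_cons, List.foldr_nil,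
    List.map_cons, List.map_nil, List.sum_cons, List.sum_nil]
  push_cast
  ring

/-! ### From 27 points to all `w` -/

/-- Evaluating the polynomial `certE (C m) X ∈ ℝ[X]` at `x` gives `certE m x`. [folklore] -/
private theorem eval_certE (m x : ℝ) : (certE (C m) (X : ℝ[X])).eval x = certE m x := by
  have h := map_certE (evalRingHom x) (C m) (X : ℝ[X])
  rw [coe_evalRingHom, eval_C, eval_X] at h
  exact h

/-- `deg_w certE(C m, X) ≤ 26`. Computed certificate for [cite: KrattenthalerZudilin2019, §4 eq. (8)]. -/
theorem natDegree_certE_le (m : ℝ) : (certE (C m) (X : ℝ[X])).natDegree ≤ 26 := by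
  have hA : (certA (C m) (X : ℝ[X])).natDegree ≤ 5 := by unfold certA; compute_degree
  have hB : (certB (C m) (X : ℝ[X])).natDegree ≤ 5 := by unfold certB; compute_degree
  have hR : (certRHS (C m) (X : ℝ[X])).natDegree ≤ 24 := by unfold certRHS; compute_degree
  have h1 : (X + 1 : ℝ[X]).natDegree ≤ 1 := by compute_degree
  have hY1 : (certY (C m) (X + 1 : ℝ[X])).natDegree ≤ 21 := (natDegree_certY_le m _).trans (by omega)
  have hY0 : (certY (C m) (X : ℝ[X])).natDegree ≤ 21 :=
    (natDegree_certY_le m _).trans (by rw [natDegree_X])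
  have h128 : (128 : ℝ[X]).natDegree ≤ 0 := by compute_degree
  have hT1 := natDegree_mul_le_of_le (natDegree_mul_le_of_le h128 hA) hY1
  have hT2 := natDegree_mul_le_of_le (natDegree_mul_le_of_le h128 hB) hY0
  unfold certE
  exact (natDegree_sub_le _ _).trans (max_le ((natDegree_sub_le _ _).trans (max_le hT1 hT2))
    (hR.trans (by norm_num)))

/-- **The certificate identity**: `certE m w = 0` for all real `m, w` — the creative-telescoping identity of
the `₅F₄` side of eq. (8) in cleared, centred form. Computed certificate for
[cite: KrattenthalerZudilin2019, §4 eq. (8)]. -/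
theorem certE_eq_zero (m w : ℝ) : certE m w = 0 := by
  have hzero : certE (C m) (X : ℝ[X]) = 0 := by
    refine eq_zero_of_natDegree_lt_card_of_eval_eq_zero _ (f := fun i : Fin 27 => ((i : ℕ) : ℝ))
      ?_ ?_ ?_
    · intro a b h
      have h' : ((a : ℕ) : ℝ) = ((b : ℕ) : ℝ) := h
      exact Fin.ext (by exact_mod_cast h')
    · intro i
      rw [eval_certE]
      obtain ⟨k, hk⟩ := i
      show certE m ((k : ℕ) : ℝ) = 0
      interval_cases k
      all_goals
        first
        | exact certE_at_0 m
        | exact certE_at_1 m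
        | exact certE_at_2 m
        | exact certE_at_3 m
        | exact certE_at_4 m
        | exact certE_at_5 m
        | exact certE_at_6 m
        | exact certE_at_7 m
        | exact certE_at_8 m
        | exact certE_at_9 m
        | exact certE_at_10 m
        | exact certE_at_11 m
        | exact certE_at_12 m
        | exact certE_at_13 m
        | exact certE_at_14 m
        | exact certE_at_15 m
        | exact certE_at_16 m
        | exact certE_at_17 m
        | exact certE_at_18 m
        | exact certE_at_19 m
        | exact certE_at_20 m
        | exact certE_at_21 m
        | exact certE_at_22 m
        | exact certE_at_23 m
        | exact certE_at_24 m
        | exact certE_at_25 m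
        | exact certE_at_26 m
    · simpa using Nat.lt_succ_of_le (natDegree_certE_le m)
  have h := eval_certE m w
  rw [hzero, eval_zero] at h
  exact h.symm

end EqEight

end Literature.NumberTheory.Irrationality.KrattenthalerZudilin2019
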